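import Mathlib.Analysis.Calculus.FDeriv.Analytic
import Mathlib.Analysis.Analytic.Constructions
import Mathlib.Analysis.Calculus.InverseFunctionTheorem.FDeriv
import Mathlib.Analysis.Calculus.FDeriv.Mul
import Mathlib.Analysis.Calculus.FDeriv.Pow
import Mathlib.Analysis.SpecialFunctions.ExpDeriv
import Mathlib.Topology.Algebra.Module.FiniteDimension
import Mathlib.LinearAlgebra.FiniteDimensional.Basic
import Mathlib.LinearAlgebra.Matrix.ToLinearEquiv
import Literature.ModelTheory.ExponentialFields.Desingularisation
import HarnessLib

/-!
# Wilkie's desingularisation for flat exponential polynomials over `ℝ` — proved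

Family `periods` (periods.S27), topic `Literature/ModelTheory/ExponentialFields`.  This file
**discharges** the named fact
`Literature.ModelTheory.ExponentialFields.Wilkie1996_flatDesingularisation`
(`Desingularisation.lean`; leaf (B2) of the decomposition of the conditional half of
Macintyre–Wilkie's theorem `macintyre_wilkie`):

> if `f ∈ ℤ[x₁…x_N, y₁…y_N]` and `x̄ ↦ f(x̄, e^{x̄})` has a real zero, then its zero set contains a
> non-singular common zero of some `f₁, …, f_N ∈ ℤ[x̄, ȳ]` (evaluated at `(x̄, e^{x̄})`).

The statement is the special case `K = ℝ`, `M = ℤ[x̄, e^{x̄}]`, `S = V(f)` of Wilkie's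
desingularisation theorem (Wilkie, J. Amer. Math. Soc. 9 (1996), Thm. 5.1 as cited by Jones–Servi
2011, proof of Thm. 3.11; den Besten 2016, Thm. 3.3.4), whose printed proof runs through
o-minimality of the ambient structure and Noetherianity of `M`.  **The proof given here is a
different, elementary analytic one**, available because every function `x̄ ↦ P(x̄, e^{x̄})` is
real-analytic on all of `ℝᴺ`: closure of the ring under `∂/∂xₖ` and analyticity suffice, and
neither o-minimality of `ℝ_exp` nor Noetherianity is used.

## The argument (`Desingularisation.Adm.exists_nonsingular_zero`)

Call a family `𝓜` of real functions on an open `U ⊆ ℝ^ι` *admissible* (`Desingularisation.Adm`)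
if its members are analytic on `U`, it is closed under `+, ·, −`, contains `ℤ` and the coordinate
functions, and is closed under the partial derivatives `∂ᵢ` up to equality on `U`.  We prove, by
induction on `card ι`: a zero `a₀ ∈ U` of `F ∈ 𝓜` can be moved inside `V(F) ∩ U` to a common zero
`a` of `card ι` members of `𝓜` whose differentials at `a` are linearly independent.

* *Dichotomy* (`Adm.exists_transversal_or_eventuallyEq_zero`).  Either some `H ∈ 𝓜` has
  `H(a₀) = 0`, `∂ₖH(a₀) ≠ 0`; or every member vanishing at `a₀` has vanishing gradient there, in
  which case all iterated partial derivatives of `F` vanish at `a₀` (induction on the word, using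
  closure under `∂ᵢ`), so `F ≡ 0` near `a₀` by Taylor expansion
  (`eventuallyEq_zero_of_iterPD_eq_zero`: Mathlib's `HasFPowerSeriesOnBall.hasSum_iteratedFDeriv`,
  multilinear expansion along the standard basis, and `iteratedFDeriv` on basis vectors =
  iterated partials).  In the second case one moves `a₀` along the `k`-th axis to a rational
  `k`-th coordinate `n/d` and takes `H = d·xₖ − n` (`Adm.exists_transversal_of_eventuallyEq_zero`).
* *Chart* (`Desingularisation.ChartData`).  `Ψ(x) = (x with xₖ replaced by H(x))` is a local
  analytic diffeomorphism at `a₀` (inverse function theorem,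
  `HasStrictFDerivAt.toOpenPartialHomeomorph`, and Mathlib's **analytic** inverse function theorem
  `OpenPartialHomeomorph.analyticAt_symm'`); `c(x') = Ψ⁻¹(x', 0)` charts `V(H)` near `a₀` over
  `ℝ^{ι∖k}`, with `∂ⱼc = eⱼ − (∂ⱼH/∂ₖH) eₖ` (`ChartData.fderiv_chart_single`).
* *Induced family* (`ChartData.M'`, `ChartData.adm_M'`).  On the open set `U'` of good parameters,
  the functions `F'` with `F' · (u ∘ c)^m = G ∘ c` for some `G ∈ 𝓜`, `m ∈ ℕ` (`u ∈ 𝓜` agreeing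
  with `∂ₖH` on `U`) form an admissible family on `ℝ^{ι∖k}`: closure under `∂ⱼ` is the identity
  `∂ⱼF' · u^{m+2} = (u·DⱼG − m·G·Dⱼu) ∘ c`, `Dⱼ = u ∂ⱼ − (∂ⱼH) ∂ₖ` (`ChartData.pd_mem_M'`).
* *Lift.*  The induction hypothesis applied to `F ∘ c` gives `a'` and `G'ⱼ = (Gⱼ/u^{mⱼ}) ∘ c`;
  at `a = c(a')` the family `(H, (Gⱼ)ⱼ)` vanishes and has independent differentials (test
  against the tangent vectors `∂ⱼc(a')`, then against `eₖ`).

Finally `ℤ[x̄, e^{x̄}] = {expEval P}` is admissible on `ℝᴺ` (`ExpPoly.adm_family`: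
analyticity by `analyticAt_rexp`; `∂ₖ (expEval P) = expEval (∂_{xₖ}P + yₖ ∂_{yₖ}P)` by
`ExpPoly.fderiv_expEval_single`), and linear independence of the differentials is
`det (expJac g a) ≠ 0` (`Matrix.exists_vecMul_eq_zero_iff`), which proves
`Wilkie1996_flatDesingularisation_holds` — for every `N` (the hypothesis `1 ≤ N` is not needed).

## What is not here

Wilkie's theorem in its printed generality (definable `S ⊆ V(f)` open in `V(f)` and closed;
Noetherian rings of definable `C^∞` functions in an o-minimal expansion of a field) is *not*
proved: for non-analytic definable functions flatness does not force local vanishing, and that is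
where o-minimality and Noetherianity enter Wilkie's proof.  Only the analytic special case consumed
by `MacintyreWilkieConditionalHalf.lean` is.

## References

* A. J. Wilkie, *Model completeness results for expansions of the ordered field of real numbers by
  restricted Pfaffian functions and the exponential function*, J. Amer. Math. Soc. 9 (1996),
  1051–1094, Thm. 5.1 (as cited by Jones–Servi).
* G. O. Jones, T. Servi, *On the decidability of the real field with a generic power function*,
  J. Symb. Log. 76 (2011), Thm. 3.11 (proof).
* M. den Besten, *Wilkie's Theorem and the Uniform Real Schanuel Conjecture*, MSc thesis, Utrecht
  (2016), Thm. 3.3.4.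
* S. G. Krantz, H. R. Parks, *A Primer of Real Analytic Functions*, 2nd ed., Birkhäuser (2002),
  §2.2 (Taylor expansion and identity principle), Thm. 2.5.1 (real-analytic inverse function
  theorem) — the analysis used, all of it from Mathlib.
-/

universe u

noncomputable section

open scoped Topology
open Filter Set

namespace Literature.ModelTheory.ExponentialFields

namespace Desingularisation

variable {ι : Type*}

section PD

variable [DecidableEq ι]

/-- The partial derivative `∂ₖ G` of a real function on `ℝ^ι`: the Fréchet derivative evaluated
at the `k`-th standard basis vector (junk where `G` is not differentiable). [folklore] -/
def pd (k : ι) (G : (ι → ℝ) → ℝ) : (ι → ℝ) → ℝ :=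
  fun x => fderiv ℝ G x (Pi.single k 1)

/-- Iterated partial derivatives `∂_{k₁} ∂_{k₂} ⋯ ∂_{kₙ} G` along a list of coordinates. [folklore] -/
def iterPD : List ι → ((ι → ℝ) → ℝ) → (ι → ℝ) → ℝ
  | [], G => G
  | k :: l, G => pd k (iterPD l G)

/-- `iterPD [] G = G`. [folklore] -/
@[simp] theorem iterPD_nil (G : (ι → ℝ) → ℝ) : iterPD [] G = G := rfl

/-- `iterPD (k :: l) G = ∂ₖ (iterPD l G)`. [folklore] -/
@[simp] theorem iterPD_cons (k : ι) (l : List ι) (G : (ι → ℝ) → ℝ) :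
    iterPD (k :: l) G = pd k (iterPD l G) := rfl

/-- `pd` is local: functions agreeing near `x` have the same partial derivatives at `x`. [folklore] -/
theorem pd_congr_of_eventuallyEq {G G' : (ι → ℝ) → ℝ} {x : ι → ℝ} (h : G =ᶠ[𝓝 x] G') (k : ι) :
    pd k G x = pd k G' x := by
  simp only [pd, h.fderiv_eq]

/-- `iterPD` is local on open sets. [folklore] -/
theorem iterPD_eqOn_of_eqOn {U : Set (ι → ℝ)} (hU : IsOpen U) {G G' : (ι → ℝ) → ℝ}
    (h : EqOn G G' U) : ∀ l : List ι, EqOn (iterPD l G) (iterPD l G') U := by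
  intro l
  induction l with
  | nil => simpa using h
  | cons k l ih =>
    intro x hx
    simp only [iterPD_cons]
    exact pd_congr_of_eventuallyEq (Filter.eventuallyEq_of_mem (hU.mem_nhds hx) ih) k

end PD

variable [Fintype ι] [DecidableEq ι]

/-! ### Flatness: analytic functions with vanishing iterated partial derivatives -/

/-- Iterated partial derivatives of an analytic function are analytic. [folklore] -/
theorem analyticOnNhd_iterPD {U : Set (ι → ℝ)} (hU : IsOpen U) {G : (ι → ℝ) → ℝ}
    (hG : AnalyticOnNhd ℝ G U) : ∀ l : List ι, AnalyticOnNhd ℝ (iterPD l G) U := by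
  intro l
  induction l with
  | nil => simpa using hG
  | cons k l ih =>
    intro x hx
    simp only [iterPD_cons]
    have h1 : AnalyticOnNhd ℝ (fderiv ℝ (iterPD l G)) U := ih.fderiv_of_isOpen hU
    exact (ContinuousLinearMap.apply ℝ ℝ (Pi.single k (1 : ℝ))).analyticAt _ |>.comp (h1 x hx)

/-- **Iterated Fréchet derivatives on basis vectors are iterated partial derivatives.** [folklore] -/
theorem iteratedFDeriv_apply_single {U : Set (ι → ℝ)} (hU : IsOpen U) {G : (ι → ℝ) → ℝ}
    (hG : AnalyticOnNhd ℝ G U) :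
    ∀ (n : ℕ) (σ : Fin n → ι), ∀ x ∈ U,
      iteratedFDeriv ℝ n G x (fun j => Pi.single (σ j) 1) = iterPD (List.ofFn σ) G x := by
  intro n
  induction n with
  | zero =>
    intro σ x hx
    simp [List.ofFn_zero]
  | succ n ih =>
    intro σ x hx
    have hdiff : DifferentiableAt ℝ (iteratedFDeriv ℝ n G) x :=
      ((hG.iteratedFDeriv_of_isOpen hU n) x hx).differentiableAt
    rw [hdiff.iteratedFDeriv_succ_apply_left', List.ofFn_succ, iterPD_cons, pd]
    have hev : (fun y => iteratedFDeriv ℝ n G y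
        (Fin.tail fun j : Fin (n + 1) => (Pi.single (σ j) (1 : ℝ) : ι → ℝ))) =ᶠ[𝓝 x]
        iterPD (List.ofFn fun i => σ i.succ) G := by
      filter_upwards [hU.mem_nhds hx] with y hy
      exact ih (fun i => σ i.succ) y hy
    rw [hev.fderiv_eq]

/-- **An analytic function all of whose iterated partial derivatives vanish at a point vanishes
near that point** (Taylor expansion at the point: the iterated Fréchet derivatives vanish on tuples
of basis vectors, hence on diagonals by multilinearity). [folklore] -/
theorem eventuallyEq_zero_of_iterPD_eq_zero {G : (ι → ℝ) → ℝ} {a : ι → ℝ} (hG : AnalyticAt ℝ G a)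
    (h : ∀ l : List ι, iterPD l G a = 0) : G =ᶠ[𝓝 a] 0 := by
  obtain ⟨p, r, hp⟩ := hG
  have hU : IsOpen (Metric.eball a r) := Metric.isOpen_eball
  have hGU : AnalyticOnNhd ℝ G (Metric.eball a r) := fun y hy => hp.analyticAt_of_mem hy
  have ha : a ∈ Metric.eball a r := Metric.mem_eball_self hp.r_pos
  have hdiag : ∀ (n : ℕ) (y : ι → ℝ), iteratedFDeriv ℝ n G a (fun _ => y) = 0 := by
    intro n y
    have hy0 : y = ∑ i, y i • (Pi.single i (1 : ℝ) : ι → ℝ) := by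
      ext j
      simp [Finset.sum_apply, Pi.single_apply]
    have hy : (fun _ : Fin n => y) = fun _ => ∑ i, y i • (Pi.single i (1 : ℝ) : ι → ℝ) := by
      funext j
      exact hy0
    rw [hy, ContinuousMultilinearMap.map_sum]
    refine Finset.sum_eq_zero fun σ _ => ?_
    rw [ContinuousMultilinearMap.map_smul_univ, iteratedFDeriv_apply_single hU hGU n σ a ha,
      h, smul_zero]
  have hball : ∀ z ∈ Metric.eball a r, G z = 0 := by
    intro z hz
    have hy : z - a ∈ Metric.eball (0 : ι → ℝ) r := by
      rw [Metric.mem_eball, edist_eq_enorm_sub] at hz ⊢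
      simpa using hz
    have hs := hp.hasSum_iteratedFDeriv hy
    simp only [hdiag, smul_zero] at hs
    rw [add_sub_cancel] at hs
    exact hs.unique hasSum_zero
  filter_upwards [hU.mem_nhds ha] with z hz
  exact hball z hz

/-! ### Linear algebra on `ℝ^ι` -/

/-- A vector of `ℝ^ι` is the combination of the standard basis vectors with its coordinates. [folklore] -/
theorem eq_sum_smul_single (y : ι → ℝ) : y = ∑ i, y i • (Pi.single i (1 : ℝ) : ι → ℝ) := by
  ext j
  simp [Finset.sum_apply, Pi.single_apply]

/-- A linear functional on `ℝ^ι` evaluated through the standard basis. [folklore] -/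
theorem clm_apply_eq_sum (φ : (ι → ℝ) →L[ℝ] ℝ) (w : ι → ℝ) :
    φ w = ∑ i, w i * φ (Pi.single i 1) := by
  conv_lhs => rw [eq_sum_smul_single w]
  simp [map_sum, map_smul, smul_eq_mul]

/-- A linear functional on `ℝ^ι` vanishing on the standard basis vanishes. [folklore] -/
theorem clm_eq_zero_of_apply_single (φ : (ι → ℝ) →L[ℝ] ℝ) (h : ∀ i, φ (Pi.single i 1) = 0) :
    φ = 0 := by
  ext w
  · rw [clm_apply_eq_sum]
    simp [h]

/-- **Chart data**: an analytic function `H` vanishing at `a₀` with `∂ₖ H (a₀) ≠ 0`. [folklore] -/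
structure ChartData (ι : Type*) [Fintype ι] [DecidableEq ι] where
  /-- the distinguished coordinate -/
  k : ι
  /-- the function whose zero set is charted -/
  H : (ι → ℝ) → ℝ
  /-- the base point -/
  a₀ : ι → ℝ
  analyticAt : AnalyticAt ℝ H a₀
  apply_eq_zero : H a₀ = 0
  pd_ne_zero : pd k H a₀ ≠ 0

namespace ChartData

variable (D : ChartData ι)

/-- The map `Ψ(x) = (x with k-th coordinate replaced by H x)`. [folklore] -/
def psi (x : ι → ℝ) : ι → ℝ := fun i => if i = D.k then D.H x else x i

/-- The `k`-th coordinate of `Ψ(x)` is `H(x)`. [folklore] -/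
theorem psi_apply_k (x : ι → ℝ) : D.psi x D.k = D.H x := by simp [psi]

/-- The other coordinates of `Ψ(x)` are those of `x`. [folklore] -/
theorem psi_apply_ne (x : ι → ℝ) {i : ι} (hi : i ≠ D.k) : D.psi x i = x i := by simp [psi, hi]

/-- The derivative of `Ψ` at `a₀`, as a continuous linear map. [folklore] -/
def psiDeriv : (ι → ℝ) →L[ℝ] (ι → ℝ) :=
  ContinuousLinearMap.pi fun i => if i = D.k then fderiv ℝ D.H D.a₀ else ContinuousLinearMap.proj i

/-- Coordinates of the derivative of `Ψ`. [folklore] -/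
theorem psiDeriv_apply (w : ι → ℝ) (i : ι) :
    D.psiDeriv w i = if i = D.k then fderiv ℝ D.H D.a₀ w else w i := by
  unfold psiDeriv
  split_ifs with h <;> simp [h]

/-- `Ψ` is strictly differentiable at `a₀` with derivative `psiDeriv`. [folklore] -/
theorem hasStrictFDerivAt_psi : HasStrictFDerivAt D.psi D.psiDeriv D.a₀ := by
  unfold psi psiDeriv
  rw [hasStrictFDerivAt_pi]
  intro i
  split_ifs with h
  · exact D.analyticAt.hasStrictFDerivAt
  · exact hasStrictFDerivAt_apply i D.a₀

/-- The derivative of `Ψ` at `a₀` is injective, because `∂ₖ H(a₀) ≠ 0`. [folklore] -/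
theorem psiDeriv_injective : Function.Injective D.psiDeriv := by
  refine (injective_iff_map_eq_zero D.psiDeriv).2 fun w hw => ?_
  have hne : ∀ i, i ≠ D.k → w i = 0 := fun i hi => by
    have := congrFun hw i
    simpa [psiDeriv_apply, hi] using this
  have hk : fderiv ℝ D.H D.a₀ w = 0 := by
    have := congrFun hw D.k
    simpa [psiDeriv_apply] using this
  have hw' : w = w D.k • (Pi.single D.k (1 : ℝ) : ι → ℝ) := by
    ext i
    by_cases hi : i = D.k
    · subst hi; simp
    · simp [hi, hne i hi]
  rw [hw', map_smul, smul_eq_mul] at hk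
  have hwk : w D.k = 0 := by
    rcases mul_eq_zero.1 hk with h | h
    · exact h
    · exact absurd h D.pd_ne_zero
  rw [hw', hwk, zero_smul]

/-- The derivative of `Ψ` at `a₀` as a continuous linear equivalence. [folklore] -/
def psiEquiv : (ι → ℝ) ≃L[ℝ] (ι → ℝ) :=
  (LinearEquiv.ofInjectiveEndo (D.psiDeriv : (ι → ℝ) →ₗ[ℝ] (ι → ℝ)) D.psiDeriv_injective).toContinuousLinearEquiv

/-- `psiEquiv` is `psiDeriv` as a map. [folklore] -/
theorem coe_psiEquiv : (D.psiEquiv : (ι → ℝ) →L[ℝ] (ι → ℝ)) = D.psiDeriv := by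
  ext w i
  · simp [psiEquiv]

/-- `Ψ` is strictly differentiable at `a₀` with invertible derivative `psiEquiv`. [folklore] -/
theorem hasStrictFDerivAt_psi' :
    HasStrictFDerivAt D.psi (D.psiEquiv : (ι → ℝ) →L[ℝ] (ι → ℝ)) D.a₀ := by
  rw [coe_psiEquiv]; exact D.hasStrictFDerivAt_psi

/-- The local analytic diffeomorphism `Ψ` near `a₀` (inverse function theorem). [folklore] -/
def loc : OpenPartialHomeomorph (ι → ℝ) (ι → ℝ) :=
  D.hasStrictFDerivAt_psi'.toOpenPartialHomeomorph D.psi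

/-- The local homeomorphism `loc` is `Ψ` as a map. [folklore] -/
theorem coe_loc : (D.loc : (ι → ℝ) → (ι → ℝ)) = D.psi := rfl

/-- `a₀` lies in the source of `loc`. [folklore] -/
theorem a₀_mem_source : D.a₀ ∈ D.loc.source :=
  D.hasStrictFDerivAt_psi'.mem_toOpenPartialHomeomorph_source

/-- `Ψ(a₀)` lies in the target of `loc`. [folklore] -/
theorem psi_a₀_mem_target : D.psi D.a₀ ∈ D.loc.target :=
  D.hasStrictFDerivAt_psi'.image_mem_toOpenPartialHomeomorph_target

/-- `Ψ` is analytic at `a₀`. [folklore] -/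
theorem analyticAt_psi : AnalyticAt ℝ D.psi D.a₀ := by
  unfold psi
  refine AnalyticAt.pi fun i => ?_
  split_ifs with h
  · exact D.analyticAt
  · exact (ContinuousLinearMap.proj (R := ℝ) i).analyticAt D.a₀

/-- **The inverse of `Ψ` is analytic at `Ψ(a₀)`** (analytic inverse function theorem, Mathlib's `OpenPartialHomeomorph.analyticAt_symm'`). [folklore] -/
theorem analyticAt_symm : AnalyticAt ℝ D.loc.symm (D.psi D.a₀) := by
  have h := D.loc.analyticAt_symm' (i := D.psiEquiv) D.a₀_mem_source
    (by rw [coe_loc]; exact D.analyticAt_psi)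
    (by rw [coe_loc]; exact D.hasStrictFDerivAt_psi'.hasFDerivAt.fderiv)
  rwa [coe_loc] at h

/-- The index type of the chart: the coordinates other than `k`. [folklore] -/
abbrev idx : Type _ := {i : ι // i ≠ D.k}

/-- Extension by `0` in the `k`-th coordinate, `ℝ^{ι∖k} → ℝ^ι`. [folklore] -/
def emb : (D.idx → ℝ) →L[ℝ] (ι → ℝ) :=
  ContinuousLinearMap.pi fun i => if h : i = D.k then 0 else ContinuousLinearMap.proj (⟨i, h⟩ : D.idx)

/-- The `k`-th coordinate of `emb x'` is `0`. [folklore] -/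
theorem emb_apply_k (x' : D.idx → ℝ) : D.emb x' D.k = 0 := by simp [emb]

/-- The other coordinates of `emb x'` are those of `x'`. [folklore] -/
theorem emb_apply_ne (x' : D.idx → ℝ) {i : ι} (hi : i ≠ D.k) : D.emb x' i = x' ⟨i, hi⟩ := by
  simp [emb, hi]

/-- The coordinates of `emb x'` off `k` are those of `x'` (subtype form). [folklore] -/
theorem emb_apply_val (x' : D.idx → ℝ) (j : D.idx) : D.emb x' j.val = x' j := by
  rw [emb_apply_ne D x' j.property]

/-- Restriction to the coordinates other than `k`. [folklore] -/
def restr (x : ι → ℝ) : D.idx → ℝ := fun j => x j.val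

/-- **The chart** of the zero set of `H` near `a₀`: `c(x') = Ψ⁻¹(x', 0)`. [folklore] -/
def chart (x' : D.idx → ℝ) : ι → ℝ := D.loc.symm (D.emb x')

/-- The base point of the chart. [folklore] -/
def x₀' : D.idx → ℝ := D.restr D.a₀

/-- `emb x₀' = Ψ(a₀)` (as `H(a₀) = 0`). [folklore] -/
theorem emb_x₀' : D.emb D.x₀' = D.psi D.a₀ := by
  ext i
  by_cases hi : i = D.k
  · subst hi; rw [emb_apply_k, psi_apply_k, D.apply_eq_zero]
  · rw [emb_apply_ne D _ hi, psi_apply_ne D _ hi]; rfl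

/-- The chart maps its base point to `a₀`. [folklore] -/
theorem chart_x₀' : D.chart D.x₀' = D.a₀ := by
  rw [chart, emb_x₀', ← coe_loc]
  exact D.loc.left_inv D.a₀_mem_source

/-- On the target, `Ψ ∘ c = emb`. [folklore] -/
theorem psi_chart {x' : D.idx → ℝ} (hx : D.emb x' ∈ D.loc.target) : D.psi (D.chart x') = D.emb x' := by
  rw [← coe_loc, chart]
  exact D.loc.right_inv hx

/-- **The chart lands in the zero set of `H`** (on the target of `Ψ`). [folklore] -/
theorem H_chart {x' : D.idx → ℝ} (hx : D.emb x' ∈ D.loc.target) : D.H (D.chart x') = 0 := by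
  have := congrFun (D.psi_chart hx) D.k
  rwa [psi_apply_k, emb_apply_k] at this

/-- The chart is a section of the restriction: `(c x')ᵢ = x'ᵢ` for `i ≠ k`. [folklore] -/
theorem chart_apply_val {x' : D.idx → ℝ} (hx : D.emb x' ∈ D.loc.target) (j : D.idx) :
    D.chart x' j.val = x' j := by
  have := congrFun (D.psi_chart hx) j.val
  rwa [psi_apply_ne D _ j.property, emb_apply_val] at this

/-- Near the base point, `emb` lands in the target of `Ψ`. [folklore] -/
theorem eventually_mem_target : ∀ᶠ x' in 𝓝 D.x₀', D.emb x' ∈ D.loc.target := by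
  have hc : Continuous D.emb := D.emb.continuous
  have : D.emb D.x₀' ∈ D.loc.target := by rw [emb_x₀']; exact D.psi_a₀_mem_target
  exact hc.continuousAt.preimage_mem_nhds (D.loc.open_target.mem_nhds this)

/-- **The chart is analytic near its base point.** [folklore] -/
theorem eventually_analyticAt_chart : ∀ᶠ x' in 𝓝 D.x₀', AnalyticAt ℝ D.chart x' := by
  have h1 : ∀ᶠ z in 𝓝 (D.psi D.a₀), AnalyticAt ℝ D.loc.symm z := D.analyticAt_symm.eventually_analyticAt
  have hca : Tendsto D.emb (𝓝 D.x₀') (𝓝 (D.psi D.a₀)) := by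
    rw [← emb_x₀']; exact D.emb.continuous.continuousAt
  have h2 : ∀ᶠ x' in 𝓝 D.x₀', AnalyticAt ℝ D.loc.symm (D.emb x') := hca.eventually h1
  filter_upwards [h2] with x' hx'
  exact hx'.comp (D.emb.analyticAt x')

/-- The chart is continuous at its base point. [folklore] -/
theorem continuousAt_chart : ContinuousAt D.chart D.x₀' :=
  D.eventually_analyticAt_chart.self_of_nhds.continuousAt


/-- Splitting a sum over `ι` into the `k`-th term and the rest. [folklore] -/
theorem sum_eq_add_sum_idx (f : ι → ℝ) : ∑ i, f i = f D.k + ∑ j : D.idx, f j.val := by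
  rw [← Finset.add_sum_erase _ _ (Finset.mem_univ D.k)]
  congr 1
  exact Finset.sum_subtype _ (by simp) f

section Good

variable (U : Set (ι → ℝ)) (u : (ι → ℝ) → ℝ)

/-- The "good" points of the parameter space: the chart is analytic there, lands in the target of
`Ψ` and in `U`, and `u` does not vanish at the image. [folklore] -/
def Good (x' : D.idx → ℝ) : Prop :=
  AnalyticAt ℝ D.chart x' ∧ D.emb x' ∈ D.loc.target ∧ D.chart x' ∈ U ∧ u (D.chart x') ≠ 0

/-- The open parameter set of the chart: points near which every point is good. [folklore] -/
def U' : Set (D.idx → ℝ) := {x' | ∀ᶠ y in 𝓝 x', D.Good U u y}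

/-- `U'` is open. [folklore] -/
theorem isOpen_U' : IsOpen (D.U' U u) := isOpen_setOf_eventually_nhds

variable {U u}

/-- Every point near a point of `U'` is good. [folklore] -/
theorem eventually_good {x' : D.idx → ℝ} (hx : x' ∈ D.U' U u) : ∀ᶠ y in 𝓝 x', D.Good U u y := hx

/-- Points of `U'` are good. [folklore] -/
theorem good_of_mem {x' : D.idx → ℝ} (hx : x' ∈ D.U' U u) : D.Good U u x' :=
  (D.eventually_good hx).self_of_nhds

/-- `U'` is a neighbourhood of each of its points. [folklore] -/
theorem eventually_mem_U' {x' : D.idx → ℝ} (hx : x' ∈ D.U' U u) : ∀ᶠ y in 𝓝 x', y ∈ D.U' U u :=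
  (D.isOpen_U' U u).mem_nhds hx

/-- **The base point lies in `U'`** when `a₀ ∈ U` (open) and `u` is continuous and non-zero at `a₀`. [folklore] -/
theorem x₀'_mem_U' (hU : IsOpen U) (ha₀ : D.a₀ ∈ U) (hu : ContinuousAt u D.a₀) (hu0 : u D.a₀ ≠ 0) :
    D.x₀' ∈ D.U' U u := by
  have hc : ContinuousAt D.chart D.x₀' := D.continuousAt_chart
  have hc' : Tendsto D.chart (𝓝 D.x₀') (𝓝 D.a₀) := by
    have := hc.tendsto; rwa [chart_x₀'] at this
  have h3 : ∀ᶠ y in 𝓝 D.x₀', D.chart y ∈ U := hc' (hU.mem_nhds ha₀)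
  have h4 : ∀ᶠ y in 𝓝 D.x₀', u (D.chart y) ≠ 0 :=
    hc'.eventually (hu.eventually (isOpen_ne.mem_nhds hu0))
  filter_upwards [D.eventually_analyticAt_chart, D.eventually_mem_target, h3, h4] with y h1 h2 h3 h4
  exact ⟨h1, h2, h3, h4⟩

end Good

/-! #### The derivative of the chart -/

section Deriv

variable {x' : D.idx → ℝ} (hc : AnalyticAt ℝ D.chart x') (hev : ∀ᶠ y in 𝓝 x', D.emb y ∈ D.loc.target)

include hc hev

/-- Coordinates of the derivative of the chart off `k`: the identity. [folklore] -/
theorem fderiv_chart_apply_val (v : D.idx → ℝ) (j : D.idx) : fderiv ℝ D.chart x' v j.val = v j := by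
  have h1 : HasFDerivAt (fun y => D.chart y j.val)
      ((ContinuousLinearMap.proj (R := ℝ) (φ := fun _ : ι => ℝ) j.val).comp (fderiv ℝ D.chart x')) x' :=
    (hasStrictFDerivAt_apply (𝕜 := ℝ) j.val (D.chart x')).hasFDerivAt.comp x' hc.differentiableAt.hasFDerivAt
  have h2 : (fun y => D.chart y j.val) =ᶠ[𝓝 x'] fun y => y j := by
    filter_upwards [hev] with y hy using D.chart_apply_val hy j
  have h3 : HasFDerivAt (fun y : D.idx → ℝ => y j)
      ((ContinuousLinearMap.proj (R := ℝ) (φ := fun _ : ι => ℝ) j.val).comp (fderiv ℝ D.chart x')) x' :=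
    h1.congr_of_eventuallyEq h2.symm
  have h4 : HasFDerivAt (fun y : D.idx → ℝ => y j) (ContinuousLinearMap.proj (R := ℝ) j) x' :=
    (hasStrictFDerivAt_apply (𝕜 := ℝ) j x').hasFDerivAt
  have := congrArg (fun φ => φ v) (h3.unique h4)
  simpa using this

/-- The derivative of the chart is tangent to the zero set of `H`. [folklore] -/
theorem fderiv_H_comp_fderiv_chart (hH : DifferentiableAt ℝ D.H (D.chart x')) (v : D.idx → ℝ) :
    fderiv ℝ D.H (D.chart x') (fderiv ℝ D.chart x' v) = 0 := by
  have h1 : HasFDerivAt (fun y => D.H (D.chart y))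
      ((fderiv ℝ D.H (D.chart x')).comp (fderiv ℝ D.chart x')) x' :=
    hH.hasFDerivAt.comp x' hc.differentiableAt.hasFDerivAt
  have h2 : (fun y => D.H (D.chart y)) =ᶠ[𝓝 x'] fun _ => 0 := by
    filter_upwards [hev] with y hy using D.H_chart hy
  have h3 : HasFDerivAt (fun _ : D.idx → ℝ => (0 : ℝ))
      ((fderiv ℝ D.H (D.chart x')).comp (fderiv ℝ D.chart x')) x' :=
    h1.congr_of_eventuallyEq h2.symm
  have h4 := h3.unique (hasFDerivAt_const (0 : ℝ) x')
  have := congrArg (fun φ => φ v) h4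
  simpa using this

/-- **The derivative of the chart on a basis vector**: `∂ⱼ c = eⱼ − (∂ⱼH / ∂ₖH) eₖ`. [folklore] -/
theorem fderiv_chart_single (hH : DifferentiableAt ℝ D.H (D.chart x'))
    (hk : pd D.k D.H (D.chart x') ≠ 0) (j : D.idx) :
    fderiv ℝ D.chart x' (Pi.single j 1) =
      (Pi.single j.val (1 : ℝ) : ι → ℝ) +
        (-(pd j.val D.H (D.chart x')) / pd D.k D.H (D.chart x')) • (Pi.single D.k (1 : ℝ) : ι → ℝ) := by
  set w := fderiv ℝ D.chart x' (Pi.single j 1) with hw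
  have hval : ∀ j' : D.idx, w j'.val = if j' = j then 1 else 0 := fun j' => by
    rw [hw, D.fderiv_chart_apply_val hc hev, Pi.single_apply]
  have htan : fderiv ℝ D.H (D.chart x') w = 0 := D.fderiv_H_comp_fderiv_chart hc hev hH _
  rw [clm_apply_eq_sum, D.sum_eq_add_sum_idx] at htan
  have hsum : ∑ j' : D.idx, w j'.val * fderiv ℝ D.H (D.chart x') (Pi.single j'.val 1) =
      pd j.val D.H (D.chart x') := by
    simp only [hval, ite_mul, one_mul, zero_mul, Finset.sum_ite_eq', Finset.mem_univ, if_true]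
    rfl
  rw [hsum] at htan
  have hwk : w D.k = -(pd j.val D.H (D.chart x')) / pd D.k D.H (D.chart x') := by
    rw [eq_div_iff hk]
    have : w D.k * pd D.k D.H (D.chart x') = w D.k * fderiv ℝ D.H (D.chart x') (Pi.single D.k 1) := rfl
    linarith
  ext i
  by_cases hi : i = D.k
  · subst hi
    rw [hwk]
    simp [j.property.symm]
  · have := hval ⟨i, hi⟩
    simp only [Pi.add_apply, Pi.smul_apply, Pi.single_apply, hi, if_false, smul_zero, add_zero]
    rw [this]
    by_cases hij : (⟨i, hi⟩ : D.idx) = j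
    · subst hij; simp
    · have : i ≠ j.val := fun h => hij (Subtype.ext h)
      simp [hij, this]

/-- **Chain rule through the chart** on a basis vector: `∂ⱼ (G ∘ c) = (∂ⱼ G + t ∂ₖ G) ∘ c` with
`t = -∂ⱼH/∂ₖH`. [folklore] -/
theorem pd_comp_chart (hH : DifferentiableAt ℝ D.H (D.chart x'))
    (hk : pd D.k D.H (D.chart x') ≠ 0) {G : (ι → ℝ) → ℝ} (hG : DifferentiableAt ℝ G (D.chart x'))
    (j : D.idx) :
    pd j (fun y => G (D.chart y)) x' =
      pd j.val G (D.chart x') +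
        (-(pd j.val D.H (D.chart x')) / pd D.k D.H (D.chart x')) * pd D.k G (D.chart x') := by
  have h := (hG.hasFDerivAt.comp x' hc.differentiableAt.hasFDerivAt).fderiv
  have e : (fun y => G (D.chart y)) = G ∘ D.chart := rfl
  simp only [pd]
  rw [e, h, ContinuousLinearMap.comp_apply, D.fderiv_chart_single hc hev hH hk j, map_add, map_smul,
    smul_eq_mul]
  rfl


end Deriv

end ChartData

/-! ### Admissible families of functions -/

/-- **Admissible family** of real functions on an open set `U ⊆ ℝ^ι`: analytic on `U`, closed under
ring operations, containing the integers and the coordinate functions, and closed under partial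
derivatives up to equality on `U`. [folklore] -/
structure Adm (U : Set (ι → ℝ)) (𝓜 : Set ((ι → ℝ) → ℝ)) : Prop where
  isOpen : IsOpen U
  analyticAt : ∀ G ∈ 𝓜, ∀ x ∈ U, AnalyticAt ℝ G x
  add_mem : ∀ G ∈ 𝓜, ∀ G' ∈ 𝓜, G + G' ∈ 𝓜
  mul_mem : ∀ G ∈ 𝓜, ∀ G' ∈ 𝓜, G * G' ∈ 𝓜
  neg_mem : ∀ G ∈ 𝓜, -G ∈ 𝓜
  const_mem : ∀ n : ℤ, (fun _ => (n : ℝ)) ∈ 𝓜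
  coord_mem : ∀ i, (fun x => x i) ∈ 𝓜
  pd_mem : ∀ G ∈ 𝓜, ∀ i, ∃ G' ∈ 𝓜, EqOn (pd i G) G' U

namespace Adm

variable {U : Set (ι → ℝ)} {𝓜 : Set ((ι → ℝ) → ℝ)} (hA : Adm U 𝓜)
include hA

/-- An admissible family is closed under subtraction. [folklore] -/
theorem sub_mem {G G' : (ι → ℝ) → ℝ} (hG : G ∈ 𝓜) (hG' : G' ∈ 𝓜) : G - G' ∈ 𝓜 := by
  rw [sub_eq_add_neg]; exact hA.add_mem G hG _ (hA.neg_mem G' hG')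

/-- An admissible family is closed under powers. [folklore] -/
theorem pow_mem {G : (ι → ℝ) → ℝ} (hG : G ∈ 𝓜) : ∀ m : ℕ, G ^ m ∈ 𝓜
  | 0 => by
    have h1 := hA.const_mem 1
    have e : (fun _ : ι → ℝ => ((1 : ℤ) : ℝ)) = 1 := by funext x; simp
    rwa [e] at h1
  | m + 1 => by rw [pow_succ]; exact hA.mul_mem _ (pow_mem hG m) _ hG

/-- An admissible family is closed under multiplication by naturals. [folklore] -/
theorem natCast_mul_mem {G : (ι → ℝ) → ℝ} (hG : G ∈ 𝓜) (m : ℕ) : (fun x => (m : ℝ) * G x) ∈ 𝓜 := by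
  have h1 := hA.mul_mem _ (hA.const_mem m) _ hG
  have e : ((fun _ : ι → ℝ => ((m : ℤ) : ℝ)) * G) = fun x => (m : ℝ) * G x := by funext x; simp
  rwa [e] at h1

/-- Members of an admissible family are differentiable on `U`. [folklore] -/
theorem differentiableAt {G : (ι → ℝ) → ℝ} (hG : G ∈ 𝓜) {x : ι → ℝ} (hx : x ∈ U) :
    DifferentiableAt ℝ G x :=
  (hA.analyticAt G hG x hx).differentiableAt

/-- Members of an admissible family are continuous on `U`. [folklore] -/
theorem continuousAt {G : (ι → ℝ) → ℝ} (hG : G ∈ 𝓜) {x : ι → ℝ} (hx : x ∈ U) : ContinuousAt G x :=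
  (hA.analyticAt G hG x hx).continuousAt

end Adm

/-! ### The induced family on the chart -/

namespace ChartData

variable (D : ChartData ι) (U : Set (ι → ℝ)) (𝓜 : Set ((ι → ℝ) → ℝ)) (u : (ι → ℝ) → ℝ)

/-- **The induced family** on the parameter space of the chart: functions `F'` with
`F' · (u ∘ c)^m = G ∘ c` on `U'` for some `G ∈ 𝓜`, `m ∈ ℕ` ("`G/u^m` restricted to the zero set
of `H`"). [folklore] -/
def M' : Set ((D.idx → ℝ) → ℝ) :=
  {F' | ∃ G ∈ 𝓜, ∃ m : ℕ, EqOn (fun x' => F' x' * u (D.chart x') ^ m) (fun x' => G (D.chart x')) (D.U' U u)}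

variable {U 𝓜 u}

/-- Membership in the induced family from a representation. [folklore] -/
theorem mem_M' {F' : (D.idx → ℝ) → ℝ} {G : (ι → ℝ) → ℝ} (hG : G ∈ 𝓜) (m : ℕ)
    (h : EqOn (fun x' => F' x' * u (D.chart x') ^ m) (fun x' => G (D.chart x')) (D.U' U u)) :
    F' ∈ D.M' U 𝓜 u :=
  ⟨G, hG, m, h⟩

/-- `G ∘ c` belongs to the induced family for `G ∈ 𝓜`. [folklore] -/
theorem comp_mem_M' {G : (ι → ℝ) → ℝ} (hG : G ∈ 𝓜) : (fun x' => G (D.chart x')) ∈ D.M' U 𝓜 u :=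
  D.mem_M' hG 0 fun x' _ => by simp

section AdmM'

variable (hA : Adm U 𝓜) (hH : D.H ∈ 𝓜) (hu : u ∈ 𝓜) (huEq : EqOn (pd D.k D.H) u U)
include hA

/-- **Members of the induced family are analytic on `U'`** (`G ∘ c / (u ∘ c)^m` near each point). [folklore] -/
theorem analyticAt_M' (hu : u ∈ 𝓜) {F' : (D.idx → ℝ) → ℝ} (hF' : F' ∈ D.M' U 𝓜 u) {x' : D.idx → ℝ}
    (hx : x' ∈ D.U' U u) : AnalyticAt ℝ F' x' := by
  obtain ⟨G, hG, m, hEq⟩ := hF'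
  obtain ⟨hc, -, hcU, hu0⟩ := D.good_of_mem hx
  have h1 : AnalyticAt ℝ (fun y => G (D.chart y) / u (D.chart y) ^ m) x' := by
    refine ((hA.analyticAt G hG _ hcU).comp hc).div (((hA.analyticAt u hu _ hcU).comp hc).pow m) ?_
    exact pow_ne_zero _ hu0
  refine h1.congr ?_
  filter_upwards [D.eventually_mem_U' hx, D.eventually_good hx] with y hy hgy
  have hne : u (D.chart y) ^ m ≠ 0 := pow_ne_zero _ hgy.2.2.2
  rw [div_eq_iff hne]
  exact (hEq hy).symm

/-- The induced family is closed under addition. [folklore] -/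
theorem add_mem_M' (hu : u ∈ 𝓜) {F₁ F₂ : (D.idx → ℝ) → ℝ} (h₁ : F₁ ∈ D.M' U 𝓜 u) (h₂ : F₂ ∈ D.M' U 𝓜 u) :
    F₁ + F₂ ∈ D.M' U 𝓜 u := by
  obtain ⟨G₁, hG₁, m₁, h₁⟩ := h₁
  obtain ⟨G₂, hG₂, m₂, h₂⟩ := h₂
  refine D.mem_M' (hA.add_mem _ (hA.mul_mem _ hG₁ _ (hA.pow_mem hu m₂)) _ (hA.mul_mem _ hG₂ _ (hA.pow_mem hu m₁)))
    (m₁ + m₂) fun y hy => ?_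
  have e₁ := h₁ hy; have e₂ := h₂ hy
  simp only [Pi.add_apply, Pi.mul_apply, Pi.pow_apply] at e₁ e₂ ⊢
  rw [← e₁, ← e₂]; ring

/-- The induced family is closed under multiplication. [folklore] -/
theorem mul_mem_M' {F₁ F₂ : (D.idx → ℝ) → ℝ} (h₁ : F₁ ∈ D.M' U 𝓜 u) (h₂ : F₂ ∈ D.M' U 𝓜 u) :
    F₁ * F₂ ∈ D.M' U 𝓜 u := by
  obtain ⟨G₁, hG₁, m₁, h₁⟩ := h₁
  obtain ⟨G₂, hG₂, m₂, h₂⟩ := h₂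
  refine D.mem_M' (hA.mul_mem _ hG₁ _ hG₂) (m₁ + m₂) fun y hy => ?_
  have e₁ := h₁ hy; have e₂ := h₂ hy
  simp only [Pi.mul_apply] at e₁ e₂ ⊢
  rw [← e₁, ← e₂]; ring

/-- The induced family is closed under negation. [folklore] -/
theorem neg_mem_M' {F₁ : (D.idx → ℝ) → ℝ} (h₁ : F₁ ∈ D.M' U 𝓜 u) : -F₁ ∈ D.M' U 𝓜 u := by
  obtain ⟨G₁, hG₁, m₁, h₁⟩ := h₁
  refine D.mem_M' (hA.neg_mem _ hG₁) m₁ fun y hy => ?_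
  have e₁ := h₁ hy
  simp only [Pi.neg_apply] at e₁ ⊢
  rw [← e₁]; ring

/-- The induced family contains the integer constants. [folklore] -/
theorem const_mem_M' (n : ℤ) : (fun _ => (n : ℝ)) ∈ D.M' U 𝓜 u :=
  D.comp_mem_M' (hA.const_mem n)

/-- The induced family contains the coordinate functions (`x'ⱼ = (c x')ⱼ` on `U'`). [folklore] -/
theorem coord_mem_M' (j : D.idx) : (fun x' => x' j) ∈ D.M' U 𝓜 u := by
  refine D.mem_M' (hA.coord_mem j.val) 0 fun y hy => ?_
  simp only [pow_zero, mul_one]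
  exact (D.chart_apply_val (D.good_of_mem hy).2.1 j).symm

end AdmM'

section PdM'

variable (hA : Adm U 𝓜)
include hA

/-- **Differentiating a representation** `F' · (u ∘ c)^m = G ∘ c` on `U'` at a point of `U'`
(product rule; the identity holds near the point). [folklore] -/
theorem pd_rep (hu : u ∈ 𝓜) {F' : (D.idx → ℝ) → ℝ} {G : (ι → ℝ) → ℝ} (hG : G ∈ 𝓜) {m : ℕ}
    (hEq : EqOn (fun x' => F' x' * u (D.chart x') ^ m) (fun x' => G (D.chart x')) (D.U' U u))
    {y : D.idx → ℝ} (hy : y ∈ D.U' U u) (j : D.idx) :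
    pd j (fun z => G (D.chart z)) y =
      F' y * ((m : ℝ) * u (D.chart y) ^ (m - 1) * pd j (fun z => u (D.chart z)) y) +
        u (D.chart y) ^ m * pd j F' y := by
  obtain ⟨hc, -, hcU, -⟩ := D.good_of_mem hy
  have hF'an : AnalyticAt ℝ F' y := D.analyticAt_M' hA hu ⟨G, hG, m, hEq⟩ hy
  have hVd : HasFDerivAt (fun z => u (D.chart z)) (fderiv ℝ (fun z => u (D.chart z)) y) y :=
    ((hA.analyticAt u hu _ hcU).comp hc).differentiableAt.hasFDerivAt
  have hprod := hF'an.differentiableAt.hasFDerivAt.mul (hVd.pow m)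
  have heq : (F' * fun z => u (D.chart z) ^ m) =ᶠ[𝓝 y] fun z => G (D.chart z) := by
    filter_upwards [D.eventually_mem_U' hy] with z hz using hEq hz
  have := (hprod.congr_of_eventuallyEq heq.symm).fderiv
  simp only [pd]
  rw [this]
  simp only [FunLike.coe_add, FunLike.coe_smul, Pi.add_apply, Pi.smul_apply, smul_eq_mul, nsmul_eq_mul]

/-- **The induced family is closed under partial derivatives.** [folklore] -/
theorem pd_mem_M' (hH : D.H ∈ 𝓜) (hu : u ∈ 𝓜) (huEq : EqOn (pd D.k D.H) u U)
    {F' : (D.idx → ℝ) → ℝ} (hF' : F' ∈ D.M' U 𝓜 u) (j : D.idx) : pd j F' ∈ D.M' U 𝓜 u := by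
  obtain ⟨G, hG, m, hEq⟩ := hF'
  obtain ⟨Gj, hGj, eGj⟩ := hA.pd_mem G hG j.val
  obtain ⟨Gk, hGk, eGk⟩ := hA.pd_mem G hG D.k
  obtain ⟨Hj, hHj, eHj⟩ := hA.pd_mem D.H hH j.val
  obtain ⟨uj, huj, euj⟩ := hA.pd_mem u hu j.val
  obtain ⟨uk, huk, euk⟩ := hA.pd_mem u hu D.k
  refine D.mem_M' (G := u * (u * Gj - Hj * Gk) - fun x => (m : ℝ) * (G * (u * uj - Hj * uk)) x) ?_
    (m + 2) ?_
  · exact hA.sub_mem (hA.mul_mem _ hu _ (hA.sub_mem (hA.mul_mem _ hu _ hGj) (hA.mul_mem _ hHj _ hGk)))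
      (hA.natCast_mul_mem (hA.mul_mem _ hG _ (hA.sub_mem (hA.mul_mem _ hu _ huj) (hA.mul_mem _ hHj _ huk))) m)
  intro y hy
  obtain ⟨hc, -, hcU, hu0⟩ := D.good_of_mem hy
  have hev : ∀ᶠ z in 𝓝 y, D.emb z ∈ D.loc.target := (D.eventually_good hy).mono fun z hz => hz.2.1
  have hkH : pd D.k D.H (D.chart y) = u (D.chart y) := huEq hcU
  have hk0 : pd D.k D.H (D.chart y) ≠ 0 := by rw [hkH]; exact hu0
  -- derivatives of `G ∘ c` and `u ∘ c`
  have dG : pd j (fun z => G (D.chart z)) y = Gj (D.chart y) +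
      -(pd j.val D.H (D.chart y)) / pd D.k D.H (D.chart y) * Gk (D.chart y) := by
    rw [D.pd_comp_chart hc hev (hA.differentiableAt hH hcU) hk0 (hA.differentiableAt hG hcU) j,
      ← eGj hcU, ← eGk hcU]
  have du : pd j (fun z => u (D.chart z)) y = uj (D.chart y) +
      -(pd j.val D.H (D.chart y)) / pd D.k D.H (D.chart y) * uk (D.chart y) := by
    rw [D.pd_comp_chart hc hev (hA.differentiableAt hH hcU) hk0 (hA.differentiableAt hu hcU) j,
      ← euj hcU, ← euk hcU]
  -- the product rule for `F' · (u ∘ c)^m = G ∘ c` near `y`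
  have e1 := D.pd_rep hA hu hG hEq hy j
  have e2 : u (D.chart y) * ((m : ℝ) * u (D.chart y) ^ (m - 1)) = (m : ℝ) * u (D.chart y) ^ m := by
    cases m with
    | zero => simp
    | succ n => rw [Nat.add_sub_cancel, pow_succ]; ring
  have e3 : F' y * u (D.chart y) ^ m = G (D.chart y) := hEq hy
  have e4 : -(pd j.val D.H (D.chart y)) / pd D.k D.H (D.chart y) * u (D.chart y) = -Hj (D.chart y) := by
    rw [hkH, div_mul_cancel₀ _ hu0, eHj hcU]
  -- algebra
  rw [dG] at e1
  set t := -(pd j.val D.H (D.chart y)) / pd D.k D.H (D.chart y) with ht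
  simp only [Pi.sub_apply, Pi.mul_apply]
  linear_combination (-(u (D.chart y)) ^ 2) * e1 + (-(u (D.chart y) * F' y * pd j (fun z => u (D.chart z)) y)) * e2
    + (-((m : ℝ) * u (D.chart y) * pd j (fun z => u (D.chart z)) y)) * e3
    + (u (D.chart y) * Gk (D.chart y) - (m : ℝ) * G (D.chart y) * uk (D.chart y)) * e4
    + (-((m : ℝ) * u (D.chart y) * G (D.chart y))) * du

/-- **The induced family on the chart is admissible.** [folklore] -/
theorem adm_M' (hH : D.H ∈ 𝓜) (hu : u ∈ 𝓜) (huEq : EqOn (pd D.k D.H) u U) :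
    Adm (D.U' U u) (D.M' U 𝓜 u) where
  isOpen := D.isOpen_U' U u
  analyticAt _ hF' _ hx := D.analyticAt_M' hA hu hF' hx
  add_mem _ h₁ _ h₂ := D.add_mem_M' hA hu h₁ h₂
  mul_mem _ h₁ _ h₂ := D.mul_mem_M' hA h₁ h₂
  neg_mem _ h₁ := D.neg_mem_M' hA h₁
  const_mem n := D.const_mem_M' hA n
  coord_mem j := D.coord_mem_M' hA j
  pd_mem F' hF' j := ⟨pd j F', D.pd_mem_M' hA hH hu huEq hF' j, fun _ _ => rfl⟩

end PdM'

end ChartData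

/-! ### The dichotomy at a zero: a transversal member, or local vanishing -/

namespace Adm

variable {U : Set (ι → ℝ)} {𝓜 : Set ((ι → ℝ) → ℝ)} (hA : Adm U 𝓜)
include hA

/-- At a zero `a₀ ∈ U` of `F ∈ 𝓜`: either some member of `𝓜` vanishes at `a₀` with a non-zero
partial derivative there, or `F` vanishes identically near `a₀` (all iterated partial derivatives
of `F` then vanish at `a₀`, and `F` is analytic). [folklore] -/
theorem exists_transversal_or_eventuallyEq_zero {F : (ι → ℝ) → ℝ} (hF : F ∈ 𝓜) {a₀ : ι → ℝ}
    (ha₀ : a₀ ∈ U) (hFa : F a₀ = 0) :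
    (∃ H ∈ 𝓜, H a₀ = 0 ∧ ∃ k, pd k H a₀ ≠ 0) ∨ F =ᶠ[𝓝 a₀] 0 := by
  by_cases h : ∃ H ∈ 𝓜, H a₀ = 0 ∧ ∃ k, pd k H a₀ ≠ 0
  · exact Or.inl h
  right
  push Not at h
  have key : ∀ l : List ι, ∃ G ∈ 𝓜, EqOn (iterPD l F) G U ∧ G a₀ = 0 := by
    intro l
    induction l with
    | nil => exact ⟨F, hF, fun _ _ => rfl, hFa⟩
    | cons k l ih =>
      obtain ⟨G, hG, hEq, hG0⟩ := ih
      obtain ⟨G', hG', hEq'⟩ := hA.pd_mem G hG k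
      refine ⟨G', hG', fun x hx => ?_, ?_⟩
      · rw [iterPD_cons, pd_congr_of_eventuallyEq (eventuallyEq_of_mem (hA.isOpen.mem_nhds hx) hEq) k]
        exact hEq' hx
      · rw [← hEq' ha₀]; exact h G hG hG0 k
  refine eventuallyEq_zero_of_iterPD_eq_zero (hA.analyticAt F hF a₀ ha₀) fun l => ?_
  obtain ⟨G, hG, hEq, hG0⟩ := key l
  rw [hEq ha₀, hG0]

/-- If `F` vanishes near `a₀ ∈ U`, then moving `a₀` along the `k`-th axis to a rational `k`-th
coordinate `q = n/d` gives a zero `a₁ ∈ U` of `F` at which `H = d·xₖ − n ∈ 𝓜` vanishes with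
`∂ₖ H = d ≠ 0`. [folklore] -/
theorem exists_transversal_of_eventuallyEq_zero {F : (ι → ℝ) → ℝ} {a₀ : ι → ℝ} (ha₀ : a₀ ∈ U)
    (hF0 : F =ᶠ[𝓝 a₀] 0) (k : ι) :
    ∃ a₁ ∈ U, F a₁ = 0 ∧ ∃ H ∈ 𝓜, H a₁ = 0 ∧ pd k H a₁ ≠ 0 := by
  have hcont : Continuous fun s : ℝ => Function.update a₀ k s := continuous_const.update k continuous_id
  have h1 : Tendsto (fun s : ℝ => Function.update a₀ k s) (𝓝 (a₀ k)) (𝓝 a₀) := by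
    have := hcont.continuousAt (x := a₀ k)
    rwa [ContinuousAt, Function.update_eq_self] at this
  have hev0 : ∀ᶠ x in 𝓝 a₀, x ∈ U ∧ F x = 0 := by
    filter_upwards [hA.isOpen.mem_nhds ha₀, hF0] with x hx hF using ⟨hx, hF⟩
  have hev : ∀ᶠ s in 𝓝 (a₀ k), Function.update a₀ k s ∈ U ∧ F (Function.update a₀ k s) = 0 :=
    h1.eventually hev0
  obtain ⟨ε, hε, hball⟩ := Metric.eventually_nhds_iff.1 hev
  obtain ⟨q, hq⟩ := exists_rat_near (a₀ k) hε
  have hq' : dist (q : ℝ) (a₀ k) < ε := by rwa [dist_comm, Real.dist_eq]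
  obtain ⟨hU₁, hF₁⟩ := hball hq'
  refine ⟨Function.update a₀ k q, hU₁, hF₁, fun x => (q.den : ℝ) * x k - q.num, ?_, ?_, ?_⟩
  · have h := hA.sub_mem (hA.natCast_mul_mem (hA.coord_mem k) q.den) (hA.const_mem q.num)
    exact h
  · have : (q : ℝ) * q.den = q.num := by exact_mod_cast Rat.mul_den_eq_num q
    simp only [Function.update_self]
    linarith
  · have hd : HasFDerivAt (fun x : ι → ℝ => (q.den : ℝ) * x k - q.num)
        ((q.den : ℝ) • ContinuousLinearMap.proj (R := ℝ) k) (Function.update a₀ k q) :=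
      ((hasStrictFDerivAt_apply (𝕜 := ℝ) k _).hasFDerivAt.const_mul (q.den : ℝ)).sub_const _
    simp only [pd, hd.fderiv]
    simp [q.den_nz]

end Adm

/-! ### The induction -/

/-- **Desingularisation for admissible families** (the analytic route): a zero in `U` of a member
`F` of an admissible family on `ℝ^ι` can be moved, inside the zero set of `F`, to a common zero of
`card ι` members of the family whose differentials there are linearly independent. By induction on
`card ι` through the charts of `ChartData`. [folklore] -/
theorem Adm.exists_nonsingular_zero :
    ∀ (n : ℕ) {κ : Type u} [Fintype κ] [DecidableEq κ], Fintype.card κ = n →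
      ∀ {U : Set (κ → ℝ)} {𝓜 : Set ((κ → ℝ) → ℝ)}, Adm U 𝓜 →
        ∀ {F : (κ → ℝ) → ℝ}, F ∈ 𝓜 → ∀ {a₀ : κ → ℝ}, a₀ ∈ U → F a₀ = 0 →
          ∃ a ∈ U, F a = 0 ∧ ∃ G : κ → (κ → ℝ) → ℝ,
            (∀ i, G i ∈ 𝓜) ∧ (∀ i, G i a = 0) ∧ LinearIndependent ℝ fun i => fderiv ℝ (G i) a := by
  intro n
  induction n with
  | zero =>
    intro κ _ _ hcard U 𝓜 hA F hF a₀ ha₀ hFa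
    haveI : IsEmpty κ := Fintype.card_eq_zero_iff.1 hcard
    exact ⟨a₀, ha₀, hFa, fun i => isEmptyElim i, fun i => isEmptyElim i, fun i => isEmptyElim i,
      linearIndependent_empty_type⟩
  | succ n ih =>
    intro κ _ _ hcard U 𝓜 hA F hF a₀ ha₀ hFa
    -- a zero `a₁` with a transversal member `H`
    obtain ⟨a₁, ha₁, hFa₁, H, hH, hH0, k, hk⟩ :
        ∃ a₁ ∈ U, F a₁ = 0 ∧ ∃ H ∈ 𝓜, H a₁ = 0 ∧ ∃ k, pd k H a₁ ≠ 0 := by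
      rcases hA.exists_transversal_or_eventuallyEq_zero hF ha₀ hFa with h | h
      · exact ⟨a₀, ha₀, hFa, h⟩
      · have hne : Nonempty κ := Fintype.card_pos_iff.1 (by omega)
        obtain ⟨k⟩ := hne
        obtain ⟨a₁, ha₁, hFa₁, H, hH, hH0, hk⟩ := hA.exists_transversal_of_eventuallyEq_zero ha₀ h k
        exact ⟨a₁, ha₁, hFa₁, H, hH, hH0, k, hk⟩
    -- the chart of `V(H)` near `a₁` and the induced admissible family
    obtain ⟨D, hH, ha₁, hFa₁⟩ : ∃ D : ChartData κ, D.H ∈ 𝓜 ∧ D.a₀ ∈ U ∧ F D.a₀ = 0 :=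
      ⟨⟨k, H, a₁, hA.analyticAt H hH a₁ ha₁, hH0, hk⟩, hH, ha₁, hFa₁⟩
    obtain ⟨u, hu, huEq⟩ := hA.pd_mem D.H hH D.k
    have hu0 : u D.a₀ ≠ 0 := by rw [← huEq ha₁]; exact D.pd_ne_zero
    have hA' : Adm (D.U' U u) (D.M' U 𝓜 u) := D.adm_M' hA hH hu huEq
    have hx₀ : D.x₀' ∈ D.U' U u := D.x₀'_mem_U' hA.isOpen ha₁ (hA.continuousAt hu ha₁) hu0
    have hF' : (fun x' => F (D.chart x')) ∈ D.M' U 𝓜 u := D.comp_mem_M' hF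
    have hF'0 : F (D.chart D.x₀') = 0 := by rw [D.chart_x₀']; exact hFa₁
    have hcard' : Fintype.card D.idx = n := by
      simp [ChartData.idx, Fintype.card_subtype_compl, hcard]
    obtain ⟨a', ha', hFa', G', hG', hG'0, hli⟩ := ih hcard' hA' hF' hx₀ hF'0
    -- lift to `κ`: the point `c a'` and the family `(H, (G_j)_j)`
    obtain ⟨hc, htar, haU, hua⟩ := D.good_of_mem ha'
    have hev : ∀ᶠ z in 𝓝 a', D.emb z ∈ D.loc.target := (D.eventually_good ha').mono fun z hz => hz.2.1
    choose Gf hGf mf hEqf using hG'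
    have hHa : D.H (D.chart a') = 0 := D.H_chart htar
    have hGfa : ∀ j, Gf j (D.chart a') = 0 := fun j => by
      have h := hEqf j ha'
      simp only at h
      rw [← h, hG'0 j, zero_mul]
    have hkH : pd D.k D.H (D.chart a') = u (D.chart a') := huEq haU
    have hk0 : pd D.k D.H (D.chart a') ≠ 0 := by rw [hkH]; exact hua
    have hHd : DifferentiableAt ℝ D.H (D.chart a') := hA.differentiableAt hH haU
    -- derivatives of `G_j` on the tangent vectors `∂_{j'} c`
    have hrep : ∀ j j', fderiv ℝ (Gf j) (D.chart a') (fderiv ℝ D.chart a' (Pi.single j' 1)) =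
        u (D.chart a') ^ mf j * pd j' (G' j) a' := by
      intro j j'
      have h1 := D.pd_rep hA hu (hGf j) (hEqf j) ha' j'
      rw [hG'0 j, zero_mul, zero_add] at h1
      rw [← h1]
      have h2 := ((hA.differentiableAt (hGf j) haU).hasFDerivAt.comp a'
        hc.differentiableAt.hasFDerivAt).fderiv
      show _ = fderiv ℝ (fun z => Gf j (D.chart z)) a' (Pi.single j' 1)
      rw [show (fun z => Gf j (D.chart z)) = Gf j ∘ D.chart from rfl, h2,
        ContinuousLinearMap.comp_apply]
    have hHtan : ∀ j', fderiv ℝ D.H (D.chart a') (fderiv ℝ D.chart a' (Pi.single j' 1)) = 0 :=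
      fun j' => D.fderiv_H_comp_fderiv_chart hc hev hHd _
    refine ⟨D.chart a', haU, hFa', fun i => if h : i = D.k then D.H else Gf ⟨i, h⟩, ?_, ?_, ?_⟩
    · intro i
      by_cases h : i = D.k
      · simp only [h, dif_pos]; exact hH
      · simp only [h, dif_neg, not_false_eq_true]; exact hGf _
    · intro i
      by_cases h : i = D.k
      · simp only [h, dif_pos]; exact hHa
      · simp only [h, dif_neg, not_false_eq_true]; exact hGfa _
    · refine Fintype.linearIndependent_iff.2 fun g hg => ?_
      have happly : ∀ w : κ → ℝ, g D.k * fderiv ℝ D.H (D.chart a') w +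
          ∑ j : D.idx, g j.val * fderiv ℝ (Gf j) (D.chart a') w = 0 := by
        intro w
        have h := congrArg (fun φ : (κ → ℝ) →L[ℝ] ℝ => φ w) hg
        simp only [FunLike.coe_sum, Finset.sum_apply, FunLike.coe_smul, Pi.smul_apply,
          smul_eq_mul, FunLike.coe_zero, Pi.zero_apply] at h
        rw [D.sum_eq_add_sum_idx] at h
        simp only [dif_pos] at h
        convert h using 2
        · refine Finset.sum_congr rfl fun j _ => ?_
          simp only [j.property, dif_neg, not_false_eq_true]
      -- the coefficients off `k` vanish
      have hoff : ∀ j : D.idx, g j.val = 0 := by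
        have hsum : ∑ j : D.idx, (g j.val * u (D.chart a') ^ mf j) • fderiv ℝ (G' j) a' = 0 := by
          refine clm_eq_zero_of_apply_single _ fun j' => ?_
          have h := happly (fderiv ℝ D.chart a' (Pi.single j' 1))
          rw [hHtan j', mul_zero, zero_add] at h
          simp only [hrep] at h
          simp only [FunLike.coe_sum, Finset.sum_apply, FunLike.coe_smul, Pi.smul_apply,
            smul_eq_mul]
          rw [← h]
          refine Finset.sum_congr rfl fun j _ => ?_
          simp only [pd]; ring
        have hli' := Fintype.linearIndependent_iff.1 hli _ hsum
        intro j
        exact (mul_eq_zero.1 (hli' j)).resolve_right (pow_ne_zero _ hua)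
      -- the coefficient at `k` vanishes
      have hk' : g D.k = 0 := by
        have h := happly (Pi.single D.k 1)
        have h0 : ∑ j : D.idx, g j.val * fderiv ℝ (Gf j) (D.chart a') (Pi.single D.k 1) = 0 :=
          Finset.sum_eq_zero fun j _ => by rw [hoff j, zero_mul]
        rw [h0, add_zero] at h
        exact (mul_eq_zero.1 h).resolve_right hk0
      intro i
      by_cases h : i = D.k
      · rw [h]; exact hk'
      · exact hoff ⟨i, h⟩

end Desingularisation

/-! ### Flat integer exponential polynomials form an admissible family -/

namespace ExpPoly

open MvPolynomial

variable {N : ℕ}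

/-- The polynomial `∂_{xₖ}P + yₖ ∂_{yₖ}P` representing `∂ₖ [P(x̄, e^{x̄})]`. [folklore] -/
def pdPoly (k : Fin N) (P : MvPolynomial (Fin N ⊕ Fin N) ℤ) : MvPolynomial (Fin N ⊕ Fin N) ℤ :=
  pderiv (Sum.inl k) P + X (Sum.inr k) * pderiv (Sum.inr k) P

/-- `pdPoly` evaluates to the partial derivative `expPD`. [folklore] -/
theorem expEval_pdPoly (k : Fin N) (P : MvPolynomial (Fin N ⊕ Fin N) ℤ) (x : Fin N → ℝ) :
    expEval (pdPoly k P) x = expPD k P x := by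
  simp [pdPoly, expPD]

/-- **The ring `ℤ[x̄, e^{x̄}]` is closed under partial derivatives**: `∂ₖ (expEval P) = expEval (pdPoly k P)`. [folklore] -/
theorem pd_expEval (k : Fin N) (P : MvPolynomial (Fin N ⊕ Fin N) ℤ) :
    Desingularisation.pd k (expEval P) = expEval (pdPoly k P) := by
  funext x
  rw [Desingularisation.pd, fderiv_expEval_single, expEval_pdPoly]

/-- **Flat exponential polynomial maps are real-analytic.** [folklore] -/
theorem analyticAt_expEval (x : Fin N → ℝ) : ∀ P : MvPolynomial (Fin N ⊕ Fin N) ℤ, AnalyticAt ℝ (expEval P) x := by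
  intro P
  induction P using MvPolynomial.induction_on with
  | C a =>
    have e : expEval (C a : MvPolynomial (Fin N ⊕ Fin N) ℤ) = fun _ => (a : ℝ) := funext fun x => expEval_C a x
    rw [e]
    exact analyticAt_const
  | add p q hp hq =>
    have e : expEval (p + q) = fun x => expEval p x + expEval q x := funext fun x => expEval_add p q x
    rw [e]
    exact hp.add hq
  | mul_X p v hp =>
    have e : expEval (p * X v) = fun x => expEval p x * expPt x v := funext fun x => by
      rw [expEval_mul, expEval_X]
    rw [e]
    refine hp.mul ?_
    rcases v with i | i
    · exact (ContinuousLinearMap.proj (R := ℝ) (φ := fun _ : Fin N => ℝ) i).analyticAt x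
    · exact analyticAt_rexp.comp ((ContinuousLinearMap.proj (R := ℝ) (φ := fun _ : Fin N => ℝ) i).analyticAt x)

/-- The family of flat integer exponential polynomial maps `x̄ ↦ P(x̄, e^{x̄})`, `P ∈ ℤ[x̄, ȳ]`. [folklore] -/
def family (N : ℕ) : Set ((Fin N → ℝ) → ℝ) := Set.range (expEval (N := N))

/-- **`ℤ[x̄, e^{x̄}]` is an admissible family on `ℝᴺ`.** [folklore] -/
theorem adm_family (N : ℕ) : Desingularisation.Adm Set.univ (family N) where
  isOpen := isOpen_univ
  analyticAt := by
    rintro _ ⟨P, rfl⟩ x -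
    exact analyticAt_expEval x P
  add_mem := by
    rintro _ ⟨P, rfl⟩ _ ⟨Q, rfl⟩
    exact ⟨P + Q, funext fun x => by simp⟩
  mul_mem := by
    rintro _ ⟨P, rfl⟩ _ ⟨Q, rfl⟩
    exact ⟨P * Q, funext fun x => by simp⟩
  neg_mem := by
    rintro _ ⟨P, rfl⟩
    exact ⟨-P, funext fun x => by simp [expEval]⟩
  const_mem n := ⟨C n, funext fun x => expEval_C n x⟩
  coord_mem i := ⟨X (Sum.inl i), funext fun x => by simp⟩
  pd_mem := by
    rintro _ ⟨P, rfl⟩ i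
    exact ⟨_, ⟨pdPoly i P, rfl⟩, fun x _ => by rw [pd_expEval]⟩

end ExpPoly

/-- **Wilkie's desingularisation theorem for flat integer exponential polynomials over `ℝ`,
discharged** — by the analytic route (`Desingularisation.Adm.exists_nonsingular_zero` applied to the
admissible family `ℤ[x̄, e^{x̄}]` on `ℝᴺ`), not by Wilkie's o-minimal/Noetherian argument.
[cite: WilkieJAMS1996, Thm. 5.1 (as cited by Jones–Servi 2011, proof of Thm. 3.11)] -/
theorem Wilkie1996_flatDesingularisation_holds : Wilkie1996_flatDesingularisation := by
  intro N _ f hf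
  obtain ⟨x, hx⟩ := hf
  obtain ⟨a, -, hfa, G, hG, hGa, hli⟩ := Desingularisation.Adm.exists_nonsingular_zero (Fintype.card (Fin N)) rfl
    (ExpPoly.adm_family N) (F := ExpPoly.expEval f) ⟨f, rfl⟩ (Set.mem_univ x) hx
  choose g hg using hG
  refine ⟨g, a, hfa, fun i => by rw [hg i]; exact hGa i, fun hdet => ?_⟩
  obtain ⟨v, hv, hvM⟩ := Matrix.exists_vecMul_eq_zero_iff.2 hdet
  have hsum : ∑ l, v l • fderiv ℝ (G l) a = 0 := by
    refine Desingularisation.clm_eq_zero_of_apply_single _ fun k => ?_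
    have hk := congrFun hvM k
    simp only [Matrix.vecMul, dotProduct, ExpPoly.expJac, Matrix.of_apply, Pi.zero_apply] at hk
    simp only [FunLike.coe_sum, Finset.sum_apply, FunLike.coe_smul, Pi.smul_apply, smul_eq_mul]
    rw [← hk]
    refine Finset.sum_congr rfl fun l _ => ?_
    rw [← hg l, ExpPoly.fderiv_expEval_single]
  exact hv (funext fun l => Fintype.linearIndependent_iff.1 hli v hsum l)

end Literature.ModelTheory.ExponentialFields

end
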